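import Summits.Ventures.PercRepro.C026BallFlip
import Summits.Ventures.PercRepro.C026DefectFlips

/-!
# The defect set under the direct-access and ball maps: Theorems M′ and Z for `DB(e)` (p5, gen 15)

mine-3 (`proofs/MINE3-FLIPS.md` §5 and §7). With `DB(e)` typed (`DCDefect`, C026DefectFlips), the sealed flip of
Theorem M (C026DirectAccess) and the ball map of Theorem Z (C026BallFlip) give the deletion side of Lemma T:

* **THEOREM M′**: `card_dcDefect_openEdgeInto_le` — `#{S ∈ DB(e) : a has an open edge into D} ≤ #ac|b(H − e)`
  for every edge `e = uv`, and the mirror `card_dcDefect_openEdgeInto_le'` for `b`;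
* **THEOREM Z for `DB(xb)`**: `card_ballDom_dcDefect_xb_le` — `#Dom_Z(DB(xb)) ≤ #ac|b(H − e)`, and the mirror
  `card_ballDom_dcDefect_xa_le` — `#Dom_{Z_b}(DB(xa)) ≤ #bc|a(H − e)`.
-/

namespace PercRepro

open Finset

namespace MultiGraph

section DefectBall

variable {V E : Type*} {G : MultiGraph V E}

open Classical in
/-- **THEOREM M′ (the `a`-side)**: the configurations of `DB(e)` in which `a` has an open edge into the closed
`c`-cluster are at most as many as the cell `ac|b` of `G = H − e`. -/
theorem card_dcDefect_openEdgeInto_le [Fintype E] (a b c u v : V) :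
    (univ.filter fun ω : Config E => G.DCDefect ω a b c u v ∧ G.OpenEdgeInto ω c a).card ≤
      (univ.filter fun ω : Config E => G.Conn ω c a ∧ ¬ G.Conn ω c b).card := by
  refine le_trans (Finset.card_le_card ?_) (card_sep_openEdgeInto_le a b c)
  intro ω hω
  simp only [Finset.mem_filter, Finset.mem_univ, true_and] at hω ⊢
  obtain ⟨⟨hab, _, hca, hcb, _⟩, hop⟩ := hω
  exact ⟨hab, hca, hcb, hop⟩

open Classical in
/-- **THEOREM M′ (the `b`-side)**: `#{S ∈ DB(e) : b has an open edge into D} ≤ #bc|a(H − e)`. -/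
theorem card_dcDefect_openEdgeInto_le' [Fintype E] (a b c u v : V) :
    (univ.filter fun ω : Config E => G.DCDefect ω a b c u v ∧ G.OpenEdgeInto ω c b).card ≤
      (univ.filter fun ω : Config E => G.Conn ω c b ∧ ¬ G.Conn ω c a).card := by
  refine le_trans (Finset.card_le_card ?_) (card_sep_openEdgeInto_le b a c)
  intro ω hω
  simp only [Finset.mem_filter, Finset.mem_univ, true_and] at hω ⊢
  obtain ⟨⟨hab, _, hca, hcb, _⟩, hop⟩ := hω
  exact ⟨fun h => hab h.symm, hcb, hca, hop⟩

open Classical in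
/-- **THEOREM Z for `DB(xb)`** (INBOX 5235): the domain of the ball map around `a` on the source class `DB(xb)`
is at most as large as the cell `ac|b` of `G = H − e` (`a ≁_S b` on `DB(xb)` excludes every open `a`–`b`
walk, avoiding `D` or not). -/
theorem card_ballDom_dcDefect_xb_le [Fintype E] (a b c x : V) :
    (univ.filter fun ω : Config E => G.BallDom (fun ω => G.DCDefect ω a b c x b) c a ω).card ≤
      (univ.filter fun ω : Config E => G.Conn ω c a ∧ ¬ G.Conn ω c b).card :=
  card_ballDom_le _ c a b fun _ hω =>
    ⟨(dcDefect_xb_imp hω).2.2.2, fun h => (dcDefect_xb_imp hω).1 h.conn⟩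

open Classical in
/-- **THEOREM Z for `DB(xa)`, the mirror**: the ball map around `b` sends its domain on `DB(xa)` into `bc|a`. -/
theorem card_ballDom_dcDefect_xa_le [Fintype E] (a b c x : V) :
    (univ.filter fun ω : Config E => G.BallDom (fun ω => G.DCDefect ω a b c x a) c b ω).card ≤
      (univ.filter fun ω : Config E => G.Conn ω c b ∧ ¬ G.Conn ω c a).card :=
  card_ballDom_le _ c b a fun _ hω =>
    ⟨(dcDefect_xa_imp hω).2.2.1, fun h => (dcDefect_xa_imp hω).1 h.conn.symm⟩

end DefectBall

end MultiGraph

end PercRepro
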